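import Summits.CriticalPhenomena.PercolationContinuityZ3.Theorems.PercNearOneGluingAdditiveGluingBystanderKernel3
import Summits.CriticalPhenomena.PercolationContinuityZ3.Theorems.PercNearOneGluingAdditiveGluingRelayLayersNoDrift
import HarnessLib

/-! # Crux `PercNearOneGluing.AdditiveGluing` (stmt-CriticalPhenomena-4576) — DESIGNATION SWITCHING closes the block kernel
# whenever the un-glued minimiser is glued-below some single-deletion minimiser (exchange-certificate form, seat (d) round 3)

Support file (`--supports stmt-CriticalPhenomena-4576`); no definitions, no named facts.  CONDITIONAL on `HBLK` (block goodness in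
every weighting with fewer positive-degree vertices — the induction hypothesis of the landed assembly `stub_cone7Assembly_c5`).

`μ_u = prodBernoulli u`; relays `A ∋ b`; a block `S` disjoint from `A`; block goodness of `S` at a designation `d` (worst selection)
`BG(u,S,d) :  τ_u(d) + gain_u(d,S) ≤ reach_u(S) + pockets_u(S)`.  Two elementary facts organise the drift problem:
* **down-set** (`blockGood_mono_designated`): the right-hand side of `BG` does not depend on `d` and the left-hand side is the glued
  reliability `τ_{u/S}(d)` (`blockGrowth_glue_real_openConn`), so the set of good designations is `{d : τ_{u/S}(d) ≤ ρ(S)}` — a down-set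
  of the GLUED two-point function;
* **single-deletion minimisers are good** (`blockGood_of_bystanderMin`): for every `x' ∈ S` with a positive edge and every minimiser `d`
  of the `x'`-star-killed two-point function `τ_{u−x'}` over `A`, `BG(u,S,d)` holds (mod `HBLK`): expand over the open star of `x'`
  (`stub_bystanderLayers_c5`); relay layers are Kozma–Nitzan's Lemma 5 in block form (`stub_relayLayersNoDrift_c5`), relay-free layers are
  `HBLK` for the layer block in `u − x'` transported to the layer weighting (`blockSlack_eq_of_agree_offBlock`).
Hence **`blockGood_of_switch`**: `BG(u,S,a₀)` holds as soon as `τ_{u/S}(a₀) ≤ τ_{u/S}(d)` for SOME bystander `x'` and SOME minimiser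
`d` of `τ_{u−x'}` — no certificate, no minimality of `a₀` needed.  Census (this seat, lab/t13–t14, exact engine, random weighted graphs
n ≤ 8, |A| ≤ 5, |S| ≤ 3): of 6 690 drift instances (`a₀ = argmin τ_u` not a glued minimiser) all but 4 are closed by this switch; the
4 residual instances ("glued-dominant minimiser": `a₀` glued-strictly-above every single-deletion and whole-block-deletion minimiser) are
certified by the per-layer exchange certificates of `bystanderKernel3` / `wholeBlockKernel3`.
[cite: KozmaNitzan2024, §3.2 Thms 4–5 pp. 12–14, Lemma 5 p. 13, Question 9 p. 36]
-/

namespace Summit.CriticalPhenomena.PercolationContinuityZ3.Theorems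

open MeasureTheory Set
open Literature.Probability.LatticeModels (prodBernoulli)
open Literature.Probability.Percolation (BondConfig openConn openConnIn openGraph openCluster)
open scoped BigOperators

noncomputable section
open Classical

section SwitchClosure

open Literature.Probability.LatticeModels Literature.Probability.Percolation

variable {n : ℕ}

/-- **Block goodness only sees the weighting through the glued block**: two weightings that agree off the non-diagonal pairs inside
`N` have the same block-goodness inequality for `N` at any designation. [cite: KozmaNitzan2024, §3.1 Remark p. 5 (gluing)] -/
theorem blockSlack_eq_of_agree_offBlock (v w : Sym2 (Fin n) → unitInterval) (A N : Finset (Fin n)) (b dN : Fin n)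
    (hb : b ∈ A)
    (hagree : ∀ e : Sym2 (Fin n), ¬ ((∀ y ∈ e, y ∈ N) ∧ ¬ e.IsDiag) → w e = v e)
    (hw : (prodBernoulli w).real (openConn dN b)
          + (prodBernoulli w).real
              ((openConn dN b)ᶜ ∩ (⋃ v ∈ N, openConn dN v) ∩ (⋃ v ∈ N, openConn v b))
        ≤ (prodBernoulli w).real (⋃ v ∈ N, openConn v b)
          + (∑ W ∈ (Finset.univ : Finset (Finset (Fin n))).filter (fun W => Disjoint W A),
              (prodBernoulli w).real
                  {ω : BondConfig (Fin n) | ∀ z : Fin n, (z ∈ W ↔ ω ∈ ⋃ v ∈ N, openConn v z)}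
                * A.inf' ⟨b, hb⟩ (fun a => (prodBernoulli w).real (openConnIn ((W : Set (Fin n))ᶜ) a b)))) :
    (prodBernoulli v).real (openConn dN b)
          + (prodBernoulli v).real
              ((openConn dN b)ᶜ ∩ (⋃ v ∈ N, openConn dN v) ∩ (⋃ v ∈ N, openConn v b))
        ≤ (prodBernoulli v).real (⋃ v ∈ N, openConn v b)
          + (∑ W ∈ (Finset.univ : Finset (Finset (Fin n))).filter (fun W => Disjoint W A),
              (prodBernoulli v).real
                  {ω : BondConfig (Fin n) | ∀ z : Fin n, (z ∈ W ↔ ω ∈ ⋃ v ∈ N, openConn v z)}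
                * A.inf' ⟨b, hb⟩ (fun a => (prodBernoulli v).real (openConnIn ((W : Set (Fin n))ᶜ) a b))) := by
  have hfun : (fun e : Sym2 (Fin n) => if (∀ x ∈ e, x ∈ N) ∧ ¬ e.IsDiag then (1 : unitInterval) else w e) = (fun e : Sym2 (Fin n) => if (∀ x ∈ e, x ∈ N) ∧ ¬ e.IsDiag then (1 : unitInterval) else v e) := by
    funext e
    by_cases hc1 : (∀ x ∈ e, x ∈ N) ∧ ¬ e.IsDiag
    · rw [if_pos hc1, if_pos hc1]
    · rw [if_neg hc1, if_neg hc1]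
      exact hagree e hc1
  have h := hw
  rw [← blockGrowth_glue_real_openConn w N dN b, ← blockGrowth_glue_real_iUnion w N b,
    ← bk_pockets_glue w A N b hb, hfun, blockGrowth_glue_real_openConn v N dN b,
    blockGrowth_glue_real_iUnion v N b, bk_pockets_glue v A N b hb] at h
  exact h

/-- **The good designations form a down-set of the glued two-point function**: if `S` is `d`-good and
`τ_{u/S}(a₀) ≤ τ_{u/S}(d)`, then `S` is `a₀`-good (worst selection). [cite: KozmaNitzan2024, §3.2 Definition p. 12] -/
theorem blockGood_mono_designated (u : Sym2 (Fin n) → unitInterval) (A S : Finset (Fin n)) (b a₀ d : Fin n) (hb : b ∈ A)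
    (hle : (prodBernoulli (fun e : Sym2 (Fin n) => if (∀ y ∈ e, y ∈ S) ∧ ¬ e.IsDiag then 1 else u e)).real (openConn a₀ b) ≤ (prodBernoulli (fun e : Sym2 (Fin n) => if (∀ y ∈ e, y ∈ S) ∧ ¬ e.IsDiag then 1 else u e)).real (openConn d b))
    (hd : (prodBernoulli u).real (openConn d b)
          + (prodBernoulli u).real
              ((openConn d b)ᶜ ∩ (⋃ v ∈ S, openConn d v) ∩ (⋃ v ∈ S, openConn v b))
        ≤ (prodBernoulli u).real (⋃ v ∈ S, openConn v b)
          + (∑ W ∈ (Finset.univ : Finset (Finset (Fin n))).filter (fun W => Disjoint W A),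
              (prodBernoulli u).real
                  {ω : BondConfig (Fin n) | ∀ z : Fin n, (z ∈ W ↔ ω ∈ ⋃ v ∈ S, openConn v z)}
                * A.inf' ⟨b, hb⟩ (fun a => (prodBernoulli u).real (openConnIn ((W : Set (Fin n))ᶜ) a b)))) :
    (prodBernoulli u).real (openConn a₀ b)
          + (prodBernoulli u).real
              ((openConn a₀ b)ᶜ ∩ (⋃ v ∈ S, openConn a₀ v) ∩ (⋃ v ∈ S, openConn v b))
        ≤ (prodBernoulli u).real (⋃ v ∈ S, openConn v b)
          + (∑ W ∈ (Finset.univ : Finset (Finset (Fin n))).filter (fun W => Disjoint W A),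
              (prodBernoulli u).real
                  {ω : BondConfig (Fin n) | ∀ z : Fin n, (z ∈ W ↔ ω ∈ ⋃ v ∈ S, openConn v z)}
                * A.inf' ⟨b, hb⟩ (fun a => (prodBernoulli u).real (openConnIn ((W : Set (Fin n))ᶜ) a b))) := by
  rw [blockGrowth_glue_real_openConn u S a₀ b, blockGrowth_glue_real_openConn u S d b] at hle
  linarith

/-- **Single-deletion minimisers are good designations** (mod `HBLK`).  For `x' ∈ S` with a positive-weight edge and a minimiser `d ∈ A`
of the `x'`-star-killed two-point function, the block `S` is `d`-good in `u` (worst selection).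
[cite: KozmaNitzan2024, §3.2 Thms 4–5 pp. 12–14, Lemma 5 p. 13] -/
theorem blockGood_of_bystanderMin (u : Sym2 (Fin n) → unitInterval) (A S : Finset (Fin n)) (b x' d : Fin n) (hb : b ∈ A)
    (hSA : Disjoint S A) (hx' : x' ∈ S) (hd : d ∈ A) (hy : ∃ y : Fin n, (u s(x', y) : ℝ) ≠ 0)
    (hdmin : ∀ a ∈ A, (prodBernoulli (fun e : Sym2 (Fin n) => if (∃ y ∈ e, y ∈ ({x'} : Finset (Fin n))) then (0 : unitInterval) else u e)).real (openConn d b) ≤ (prodBernoulli (fun e : Sym2 (Fin n) => if (∃ y ∈ e, y ∈ ({x'} : Finset (Fin n))) then (0 : unitInterval) else u e)).real (openConn a b))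
    (hblk : (∀ w' : Sym2 (Fin n) → unitInterval,
        (Finset.univ.filter (fun v : Fin n => ∃ y : Fin n, 0 < (w' s(y, v) : ℝ))).card
          < (Finset.univ.filter (fun v : Fin n => ∃ y : Fin n, 0 < (u s(y, v) : ℝ))).card →
        ∀ (A' S' : Finset (Fin n)) (b' d' : Fin n) (hb' : b' ∈ A'), Disjoint S' A' → d' ∈ A' →
        (∀ a ∈ A', (prodBernoulli w').real (openConn d' b') ≤ (prodBernoulli w').real (openConn a b')) →
        (prodBernoulli w').real (openConn d' b')
          + (prodBernoulli w').real
              ((openConn d' b')ᶜ ∩ (⋃ v ∈ S', openConn d' v) ∩ (⋃ v ∈ S', openConn v b'))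
        ≤ (prodBernoulli w').real (⋃ v ∈ S', openConn v b')
          + (∑ W ∈ (Finset.univ : Finset (Finset (Fin n))).filter (fun W => Disjoint W A'),
              (prodBernoulli w').real
                  {ω : BondConfig (Fin n) | ∀ z : Fin n, (z ∈ W ↔ ω ∈ ⋃ v ∈ S', openConn v z)}
                * A'.inf' ⟨b', hb'⟩ (fun a => (prodBernoulli w').real (openConnIn ((W : Set (Fin n))ᶜ) a b'))))) :
    (prodBernoulli u).real (openConn d b)
          + (prodBernoulli u).real
              ((openConn d b)ᶜ ∩ (⋃ v ∈ S, openConn d v) ∩ (⋃ v ∈ S, openConn v b))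
        ≤ (prodBernoulli u).real (⋃ v ∈ S, openConn v b)
          + (∑ W ∈ (Finset.univ : Finset (Finset (Fin n))).filter (fun W => Disjoint W A),
              (prodBernoulli u).real
                  {ω : BondConfig (Fin n) | ∀ z : Fin n, (z ∈ W ↔ ω ∈ ⋃ v ∈ S, openConn v z)}
                * A.inf' ⟨b, hb⟩ (fun a => (prodBernoulli u).real (openConnIn ((W : Set (Fin n))ᶜ) a b))) := by
  have hx'A : x' ∉ A := Finset.disjoint_left.1 hSA hx'
  have hdx : d ≠ x' := fun h => hx'A (h ▸ hd)
  have hxT : x' ∉ S.erase x' := Finset.notMem_erase x' S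
  have hS'A : Disjoint (S.erase x') A := Finset.disjoint_of_subset_left (Finset.erase_subset x' S) hSA
  obtain ⟨y₀, hy₀⟩ := hy
  rw [← Finset.insert_erase hx']
  refine stub_bystanderLayers_c5 n u A (S.erase x') x' b d hb
    (fun B => (if Disjoint (S.erase x' ∪ B) A then (0 : ℝ) else ((prodBernoulli (fun e : Sym2 (Fin n) => if (∀ y ∈ e, y ∈ B) ∧ ¬ e.IsDiag then 1 else if (∃ y ∈ e, y ∈ ({x'} : Finset (Fin n))) then 0 else u e)).real (⋃ v ∈ (S.erase x' ∪ B), openConn v b) - ((prodBernoulli (fun e : Sym2 (Fin n) => if (∀ y ∈ e, y ∈ B) ∧ ¬ e.IsDiag then 1 else if (∃ y ∈ e, y ∈ ({x'} : Finset (Fin n))) then 0 else u e)).real (openConn d b) + (prodBernoulli (fun e : Sym2 (Fin n) => if (∀ y ∈ e, y ∈ B) ∧ ¬ e.IsDiag then 1 else if (∃ y ∈ e, y ∈ ({x'} : Finset (Fin n))) then 0 else u e)).real ((openConn d b)ᶜ ∩ (⋃ v ∈ (S.erase x' ∪ B), openConn d v) ∩ (⋃ v ∈ (S.erase x' ∪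 B), openConn v b)))))) hxT hx'A hdx ?_ ?_
  · -- the certificate is non-negative termwise: relay layers by Lemma 5 in block form, relay-free layers are `0`
    refine Finset.sum_nonneg fun B _ => mul_nonneg measureReal_nonneg ?_
    show (0 : ℝ) ≤ (if Disjoint (S.erase x' ∪ B) A then (0 : ℝ) else ((prodBernoulli (fun e : Sym2 (Fin n) => if (∀ y ∈ e, y ∈ B) ∧ ¬ e.IsDiag then 1 else if (∃ y ∈ e, y ∈ ({x'} : Finset (Fin n))) then 0 else u e)).real (⋃ v ∈ (S.erase x' ∪ B), openConn v b) - ((prodBernoulli (fun e : Sym2 (Fin n) => if (∀ y ∈ e, y ∈ B) ∧ ¬ e.IsDiag then 1 else if (∃ y ∈ e, y ∈ ({x'} : Finset (Fin n))) then 0 else u e)).real (openConn d b) + (prodBernoulli (fun e : Sym2 (Fin n) => if (∀ y ∈ e, y ∈ B) ∧ ¬ e.IsDiag then 1 else if (∃ y ∈ e, y ∈ ({x'} : Finset (Fin n))) then 0 else u e)).real ((openConn d b)ᶜ ∩ (⋃ v ∈ (S.erase x' ∪ B), openConn d v) ∩ (⋃ v ∈ (S.erase x' ∪ B), openConn v 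b)))))
    split_ifs with hdisj
    · exact le_rfl
    · exact stub_relayLayersNoDrift_c5 n u A (S.erase x') B b d x' hb hS'A hd hdmin hdisj
  · intro B hB
    have hpk0 : 0 ≤ (∑ W ∈ (Finset.univ : Finset (Finset (Fin n))).filter (fun W => Disjoint W A),
              (prodBernoulli (fun e : Sym2 (Fin n) => if (∀ y ∈ e, y ∈ B) ∧ ¬ e.IsDiag then 1 else if (∃ y ∈ e, y ∈ ({x'} : Finset (Fin n))) then 0 else u e)).real
                  {ω : BondConfig (Fin n) | ∀ z : Fin n, (z ∈ W ↔ ω ∈ ⋃ v ∈ (S.erase x' ∪ B), openConn v z)}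
                * A.inf' ⟨b, hb⟩ (fun a => (prodBernoulli (fun e : Sym2 (Fin n) => if (∀ y ∈ e, y ∈ B) ∧ ¬ e.IsDiag then 1 else if (∃ y ∈ e, y ∈ ({x'} : Finset (Fin n))) then 0 else u e)).real (openConnIn ((W : Set (Fin n))ᶜ) a b))) :=
      Finset.sum_nonneg fun W _ => mul_nonneg measureReal_nonneg (Finset.le_inf' _ _ fun a _ => measureReal_nonneg)
    show (if Disjoint (S.erase x' ∪ B) A then (0 : ℝ) else ((prodBernoulli (fun e : Sym2 (Fin n) => if (∀ y ∈ e, y ∈ B) ∧ ¬ e.IsDiag then 1 else if (∃ y ∈ e, y ∈ ({x'} : Finset (Fin n))) then 0 else u e)).real (⋃ v ∈ (S.erase x' ∪ B), openConn v b) - ((prodBernoulli (fun e : Sym2 (Fin n) => if (∀ y ∈ e, y ∈ B) ∧ ¬ e.IsDiag then 1 else if (∃ y ∈ e, y ∈ ({x'} : Finset (Fin n))) then 0 else u e)).real (openConn d b) + (prodBernoulli (fun e : Sym2 (Fin n) => if (∀ y ∈ e, y ∈ B) ∧ ¬ e.IsDiag then 1 else if (∃ y ∈ e, y ∈ ({x'}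 : Finset (Fin n))) then 0 else u e)).real ((openConn d b)ᶜ ∩ (⋃ v ∈ (S.erase x' ∪ B), openConn d v) ∩ (⋃ v ∈ (S.erase x' ∪ B), openConn v b))))) ≤ _
    split_ifs with hdisj
    · -- relay-free layer: `HBLK` for the layer block in the star-killed weighting, transported to the layer weighting
      have hlt := bk_card_lt u ({x'} : Finset (Fin n)) (Finset.mem_singleton_self x') hy₀
      have hgood : (prodBernoulli (fun e : Sym2 (Fin n) => if (∃ y ∈ e, y ∈ ({x'} : Finset (Fin n))) then (0 : unitInterval) else u e)).real (openConn d b)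
          + (prodBernoulli (fun e : Sym2 (Fin n) => if (∃ y ∈ e, y ∈ ({x'} : Finset (Fin n))) then (0 : unitInterval) else u e)).real
              ((openConn d b)ᶜ ∩ (⋃ v ∈ (S.erase x' ∪ B), openConn d v) ∩ (⋃ v ∈ (S.erase x' ∪ B), openConn v b))
        ≤ (prodBernoulli (fun e : Sym2 (Fin n) => if (∃ y ∈ e, y ∈ ({x'} : Finset (Fin n))) then (0 : unitInterval) else u e)).real (⋃ v ∈ (S.erase x' ∪ B), openConn v b)
          + (∑ W ∈ (Finset.univ : Finset (Finset (Fin n))).filter (fun W => Disjoint W A),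
              (prodBernoulli (fun e : Sym2 (Fin n) => if (∃ y ∈ e, y ∈ ({x'} : Finset (Fin n))) then (0 : unitInterval) else u e)).real
                  {ω : BondConfig (Fin n) | ∀ z : Fin n, (z ∈ W ↔ ω ∈ ⋃ v ∈ (S.erase x' ∪ B), openConn v z)}
                * A.inf' ⟨b, hb⟩ (fun a => (prodBernoulli (fun e : Sym2 (Fin n) => if (∃ y ∈ e, y ∈ ({x'} : Finset (Fin n))) then (0 : unitInterval) else u e)).real (openConnIn ((W : Set (Fin n))ᶜ) a b))) := hblk (fun e : Sym2 (Fin n) => if (∃ y ∈ e, y ∈ ({x'} : Finset (Fin n))) then (0 : unitInterval) else u e) hlt A (S.erase x' ∪ B) b d hb hdisj hd hdmin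
      have hgood' : (prodBernoulli (fun e : Sym2 (Fin n) => if (∀ y ∈ e, y ∈ B) ∧ ¬ e.IsDiag then 1 else if (∃ y ∈ e, y ∈ ({x'} : Finset (Fin n))) then 0 else u e)).real (openConn d b)
          + (prodBernoulli (fun e : Sym2 (Fin n) => if (∀ y ∈ e, y ∈ B) ∧ ¬ e.IsDiag then 1 else if (∃ y ∈ e, y ∈ ({x'} : Finset (Fin n))) then 0 else u e)).real
              ((openConn d b)ᶜ ∩ (⋃ v ∈ (S.erase x' ∪ B), openConn d v) ∩ (⋃ v ∈ (S.erase x' ∪ B), openConn v b))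
        ≤ (prodBernoulli (fun e : Sym2 (Fin n) => if (∀ y ∈ e, y ∈ B) ∧ ¬ e.IsDiag then 1 else if (∃ y ∈ e, y ∈ ({x'} : Finset (Fin n))) then 0 else u e)).real (⋃ v ∈ (S.erase x' ∪ B), openConn v b)
          + (∑ W ∈ (Finset.univ : Finset (Finset (Fin n))).filter (fun W => Disjoint W A),
              (prodBernoulli (fun e : Sym2 (Fin n) => if (∀ y ∈ e, y ∈ B) ∧ ¬ e.IsDiag then 1 else if (∃ y ∈ e, y ∈ ({x'} : Finset (Fin n))) then 0 else u e)).real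
                  {ω : BondConfig (Fin n) | ∀ z : Fin n, (z ∈ W ↔ ω ∈ ⋃ v ∈ (S.erase x' ∪ B), openConn v z)}
                * A.inf' ⟨b, hb⟩ (fun a => (prodBernoulli (fun e : Sym2 (Fin n) => if (∀ y ∈ e, y ∈ B) ∧ ¬ e.IsDiag then 1 else if (∃ y ∈ e, y ∈ ({x'} : Finset (Fin n))) then 0 else u e)).real (openConnIn ((W : Set (Fin n))ᶜ) a b))) :=
        blockSlack_eq_of_agree_offBlock (fun e : Sym2 (Fin n) => if (∀ y ∈ e, y ∈ B) ∧ ¬ e.IsDiag then 1 else if (∃ y ∈ e, y ∈ ({x'} : Finset (Fin n))) then 0 else u e) (fun e : Sym2 (Fin n) => if (∃ y ∈ e, y ∈ ({x'} : Finset (Fin n))) then (0 : unitInterval) else u e) A (S.erase x' ∪ B) b d hb (fun e he => by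
          have h2 : ¬ ((∀ y ∈ e, y ∈ B) ∧ ¬ e.IsDiag) := fun h =>
            he ⟨fun y hy => Finset.mem_union_right _ (h.1 y hy), h.2⟩
          simp only [h2, if_false]) hgood
      linarith [hgood']
    · -- relay layer: only the pockets are lost
      linarith

/-- **DESIGNATION SWITCHING (the down-set closure).**  If for some bystander `x' ∈ S` with a positive edge and some minimiser `d` of the
`x'`-star-killed two-point function the designation `a₀` is glued-below `d` (`τ_{u/S}(a₀) ≤ τ_{u/S}(d)`), then `S` is `a₀`-good (worst
selection), mod `HBLK`.  No minimality of `a₀` and no certificate are needed.  [cite: KozmaNitzan2024, §3.2 Thms 4–5 pp. 12–14] -/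
theorem blockGood_of_switch (u : Sym2 (Fin n) → unitInterval) (A S : Finset (Fin n)) (b a₀ x' d : Fin n) (hb : b ∈ A)
    (hSA : Disjoint S A) (hx' : x' ∈ S) (hd : d ∈ A) (hy : ∃ y : Fin n, (u s(x', y) : ℝ) ≠ 0)
    (hdmin : ∀ a ∈ A, (prodBernoulli (fun e : Sym2 (Fin n) => if (∃ y ∈ e, y ∈ ({x'} : Finset (Fin n))) then (0 : unitInterval) else u e)).real (openConn d b) ≤ (prodBernoulli (fun e : Sym2 (Fin n) => if (∃ y ∈ e, y ∈ ({x'} : Finset (Fin n))) then (0 : unitInterval) else u e)).real (openConn a b))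
    (hle : (prodBernoulli (fun e : Sym2 (Fin n) => if (∀ y ∈ e, y ∈ S) ∧ ¬ e.IsDiag then 1 else u e)).real (openConn a₀ b) ≤ (prodBernoulli (fun e : Sym2 (Fin n) => if (∀ y ∈ e, y ∈ S) ∧ ¬ e.IsDiag then 1 else u e)).real (openConn d b))
    (hblk : (∀ w' : Sym2 (Fin n) → unitInterval,
        (Finset.univ.filter (fun v : Fin n => ∃ y : Fin n, 0 < (w' s(y, v) : ℝ))).card
          < (Finset.univ.filter (fun v : Fin n => ∃ y : Fin n, 0 < (u s(y, v) : ℝ))).card →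
        ∀ (A' S' : Finset (Fin n)) (b' d' : Fin n) (hb' : b' ∈ A'), Disjoint S' A' → d' ∈ A' →
        (∀ a ∈ A', (prodBernoulli w').real (openConn d' b') ≤ (prodBernoulli w').real (openConn a b')) →
        (prodBernoulli w').real (openConn d' b')
          + (prodBernoulli w').real
              ((openConn d' b')ᶜ ∩ (⋃ v ∈ S', openConn d' v) ∩ (⋃ v ∈ S', openConn v b'))
        ≤ (prodBernoulli w').real (⋃ v ∈ S', openConn v b')
          + (∑ W ∈ (Finset.univ : Finset (Finset (Fin n))).filter (fun W => Disjoint W A'),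
              (prodBernoulli w').real
                  {ω : BondConfig (Fin n) | ∀ z : Fin n, (z ∈ W ↔ ω ∈ ⋃ v ∈ S', openConn v z)}
                * A'.inf' ⟨b', hb'⟩ (fun a => (prodBernoulli w').real (openConnIn ((W : Set (Fin n))ᶜ) a b'))))) :
    (prodBernoulli u).real (openConn a₀ b)
          + (prodBernoulli u).real
              ((openConn a₀ b)ᶜ ∩ (⋃ v ∈ S, openConn a₀ v) ∩ (⋃ v ∈ S, openConn v b))
        ≤ (prodBernoulli u).real (⋃ v ∈ S, openConn v b)
          + (∑ W ∈ (Finset.univ : Finset (Finset (Fin n))).filter (fun W => Disjoint W A),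
              (prodBernoulli u).real
                  {ω : BondConfig (Fin n) | ∀ z : Fin n, (z ∈ W ↔ ω ∈ ⋃ v ∈ S, openConn v z)}
                * A.inf' ⟨b, hb⟩ (fun a => (prodBernoulli u).real (openConnIn ((W : Set (Fin n))ᶜ) a b))) :=
  blockGood_mono_designated u A S b a₀ d hb hle (blockGood_of_bystanderMin u A S b x' d hb hSA hx' hd hy hdmin hblk)

end SwitchClosure

end

end Summit.CriticalPhenomena.PercolationContinuityZ3.Theorems
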